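import Summits.BirchSwinnertonDyer.BirchSwinnertonDyer.Theorems.KatoDescentTamePotSupersingularTameLowerPdescShape
import Summits.BirchSwinnertonDyer.Rank1Residual.X11b.KrausMinimalityGeneralTwo
import HarnessLib

/-!
# Route `KatoDescentTamePotSupersingular` (rung K8-t′ = KT, cell `bsd-potss`), child crux `TameLowerIntrinsicNonCM`
# (item stmt-BirchSwinnertonDyer-19618), registered stub `stub_intr_residualNonCM` (REDUCIBLE disjunct) — RECORDS part 02
# (7 classes: `286110bf`, `313290k`, `355950bj`, `466578cp`, `481050t`, `486720gq`, `487872jp`): the per-class LOWER half `MissingLowerBoundAt W 3` on INTRINSIC (t′) rank-0 classes with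
# `E[3]` reducible, from four PUBLISHED facts + ONE two-engine `3`-isogeny-descent certificate line per class
# (seat `bsd-potss-kt-pdesc`, ACCEL row (4) of planner bsd-potss-plan g14; `--supports stmt-BirchSwinnertonDyer-19618 --as helper`;
# closes NOTHING class-wide)

PARTITION (D-0054, cell bsd-potss): EXCLUDED-DOMAIN non-CM additive `p` · B4 (t′) (`e ∈ {3,4,6}`; here `p = 3`, Kodaira `III` (`e = 4`)),
`r_an = 0`, INTRINSIC classes (every member `3 ∣ #Ш_an`) × {`E[3]` reducible} — rows of the registered stub
`Sig.stub_intr_residualNonCM` of the birth skeleton v4 of 19618 (planner g15): on a reducible row `ρ̄` is not onto and the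
`3`-adic tower is not onto, so the row is off every Kurihara-certificate road of the skeleton. Per class; class-wide the stub
is Kato's Conj. 12.10 lower half at an additive potentially supersingular prime (OPEN). HONEST FRAMING: BSD is not proved by
any of this; nothing here is new mathematics; THEOREMS ONLY (no definition, no named fact, no `sorry`); nothing is booked here.

Each record instantiates `KTPdesc.missingLowerBoundAt_of_isIsogenous_ainvs_of_selmerGroup_ne_bot` (Selmer currency: classes
with no rational `3`-torsion anywhere in the class) or `KTPdesc.missingLowerBoundAt_of_isIsogenous_ainvs_of_shaWitness`
(Ш-witness currency: classes meeting rational `3`-torsion, where `3 ∣ #Ẽ(𝔽_ℓ)` at every good `ℓ` for every member) of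
`…TameLowerPdescShape.lean` on the literal Cremona model `W₀` of the certificate member; the conclusion holds at EVERY
globally minimal `W ∼_ℚ W₀` (binder `hiso` = the Cremona class datum). DECIDED IN THE KERNEL: `Δ ≠ 0`, global minimality
(`X11b.isGloballyMinimal_of_krausCriterion_support`: the support of `Δ` + Silverman / Kraus per prime) and, in the Selmer
currency, `3 ∤ #W₀(ℚ)_tors` from one odd good prime `ℓ` with `3 ∤ #Ẽ(𝔽_ℓ)` (`countPoints`). DISPLAYED binders: the
PUBLISHED named facts `hCT` (Cassels–Tate), `hCassels` (Cassels), `hGZK`, `hmod`; per class `hr` (`r_an = 0`, Cremona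
`allbsd`), `hs`/`hv` (`#Ш_an(W₀) = s`, `ord_3 s ≤ 2`; value quoted per docstring) and the certificate line `hSel :
Sel^(3)(W₀/ℚ) ≠ ⊥` resp. `hwit : ∃ x ∈ Ш(W₀), x ≠ 0, 3·x = 0`, whose EVIDENCE is quoted per record: the row of kit
**j257757** (this seat; engines 2χ `isogchi.gp` sha256 42175383… and 2cft `isogcft.gp` sha256 0e36e3a0… of cell
b2b-bsdres-sha-2, UNMODIFIED; two independent methods per kernel — Kummer side over the `S`-units of `L = ℚ(T)` vs.
class-field-theory side over the ray class group of `L` —, IDENTICAL `(ŝ, s_φ, m, excess)` on all 298 kernels run, both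
Poitou–Tate identities PASS, 112 null kernels with `ord_p #Ш_an = 0` on both sides all show excess `0`; `HOME/kt-pdesc/`).
Chain (PROVED in the tree below the named facts): `dim Ш(W₀)[φ] ≥ 1` ⇒ `Ш(W₀)[3] ≠ 0` (⇒ `Sel^(3)(W₀/ℚ) ≠ ⊥`) ⇒
`3 ∣ #Ш(W₀)` ⇒ `3² ∣ #Ш(W₀)` (Cassels–Tate) ⇒ `ord_3 #Ш_an(W₀) = 2 ≤ ord_3 #Ш(W₀)`; Cassels' isogeny invariance
carries the lower half to every member.

References: [SilvermanAEC2009] Thm. X.4.14, VII.1 Rem. 1.1, VII.3.1(b); [Kraus1989] Prop. 1–2; [MilneADT2006] Thm. I.7.3;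
[Miller2011LMS] Def. 1.1; [Cremona2006] Table 1; Schaefer, J. Number Theory 56 (1996) L. 3.8; [SchaeferStoll2004];
[Kato2004Asterisque] Conj. 12.10 (p. 224).
-/

set_option autoImplicit false
set_option linter.dupNamespace false

noncomputable section

open scoped Classical

open WeierstrassCurve Literature.NumberTheory.EllipticCurves
  Literature.NumberTheory.EllipticCurves.Rank1Residual
  Literature.NumberTheory.EllipticCurves.Rank1Residual.Typed
  Summit.BirchSwinnertonDyer.Rank1Residual

namespace Summit.BirchSwinnertonDyer.BirchSwinnertonDyer.Theorems

/-- **L₀ `MissingLowerBoundAt · 3` on the intrinsic (t′) class `286110bf`** (`E[3]` reducible, image `B`; `N =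
286110 = 2·3^2·5·11·17^2`; Kodaira type `III` at `3` (`e = 4`); members: 286110bf1 `#Ш_an = 9`, `#tors = 1`, `∏c =
8`, 286110bf2 `#Ш_an = 9`, `#tors = 1`, `∏c = 24`; no rational `3`-torsion in the class). Certificate member `W₀ =
286110bf1 = [1, -1, 0, -36113205, -104457440699]` (Cremona `allbsd`: `r_an = 0`, `#Ш_an(W₀) = 9`, `ord_3 = 2`).
Kernel-decided: `Δ(W₀) ≠ 0`, global minimality (support of `Δ` = `[(2, 1, 4), (3, 2, 3), (5, 1, 3), (11, 1, 1), (17,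
2, 15)]` as `(q, v_q N, v_q Δ)`; Silverman/Kraus disjunct per prime: 2:a, 3:a, 5:a, 11:a, 17:a), `3 ∤ #W₀(ℚ)_tors`
from `#Ẽ(𝔽_{7}) = 7`. Binders: PUBLISHED `hCT`, `hCassels`, `hGZK`, `hmod`; per class `hr`, `hs`/`hv`, `hSel :
Sel^(3)(W₀/ℚ) ≠ ⊥` — EVIDENCE: kit j257757 (this seat; 2χ `isogchi.gp` 42175383… / 2cft `isogcft.gp` 0e36e3a0…,
unmodified, AGREE, duality PASS) row `286110bf1`: rational `3`-isogeny `φ` with kernel polynomial `x - 10723`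
(kernel field degree `d = 2`) onto `286110bf2` (`#tors = 1`, `#Ш_an = 9`), `(s_φ, ŝ, m, excess) = (1, 1, 0, 2)`,
Mordell–Weil split at rank `0` `(q_φ, q_φ̂) = (0, 0)` ⇒ `dim Ш(W₀)[φ] = s_φ − q_φ = 1 ≥ 1` (and `dim
Ш(286110bf2)[φ̂] = 1`) ⇒ `Ш(W₀)[3] ≠ 0` ⇒ `Sel^(3)(W₀/ℚ) ≠ ⊥` (`W₀(ℚ)[3] = 0`); `hiso`: the Cremona class 286110bf
(2 curves). Per class; nothing booked. [cite: SilvermanAEC2009, Thm. X.4.14 and VII.1 Remark 1.1] [cite: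
Miller2011LMS, §1 and Def. 1.1] [cite: Cremona2006, Table 1 (Cremona label 286110bf1)] -/
theorem KTPdesc.lower3_sel_286110bf1 (hCT : exists_casselsTate_pairing (K := ℚ))
    (hCassels : bsdRHS_eq_of_isIsogenous) (hGZK : rank_eq_analyticRank_of_analyticRank_le_one)
    (hmod : hasEntireLFunction_rat) (W₀ : WeierstrassCurve ℚ) (hW₀ : W₀ = ⟨1, -1, 0, -36113205, -104457440699⟩)
    (hr : W₀.analyticRank = 0) {s : ℚ} (hs : shaAn W₀ = (s : ℂ)) (hv : padicValRat 3 s ≤ 2)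
    (hSel : W₀.selmerGroup (3 : ℤ) ≠ ⊥) (W : WeierstrassCurve ℚ) [W.IsElliptic] [W.IsGloballyMinimal]
    (hiso : IsIsogenous W W₀) : MissingLowerBoundAt W 3 := by
  subst hW₀
  haveI : Fact (Nat.Prime 3) := ⟨by norm_num⟩
  exact KTPdesc.missingLowerBoundAt_of_isIsogenous_ainvs_of_selmerGroup_ne_bot hCT hCassels hGZK hmod
    1 (-1) 0 (-36113205) (-104457440699)
    (X11b.isGloballyMinimal_of_krausCriterion_support 1 (-1) 0 (-36113205) (-104457440699)
      [(2, 1, 4), (3, 2, 3), (5, 1, 3), (11, 1, 1), (17, 2, 15)]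
      (by intro t ht; simp only [List.mem_cons, List.not_mem_nil, or_false] at ht; rcases ht with rfl | rfl | rfl | rfl | rfl <;> norm_num)
      (by decide +kernel) (by decide +kernel))
    3 7 (by norm_num) (by norm_num) (by decide +kernel) (n := 7) (by decide +kernel) (by decide)
    hr hs hv hSel W hiso

/-- **L₀ `MissingLowerBoundAt · 3` on the intrinsic (t′) class `313290k`** (`E[3]` reducible, image `B`; `N = 313290
= 2·3^2·5·59^2`; Kodaira type `III` at `3` (`e = 4`); members: 313290k1 `#Ш_an = 9`, `#tors = 2`, `∏c = 8`, 313290k2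
`#Ш_an = 9`, `#tors = 2`, `∏c = 8`, 313290k3 `#Ш_an = 9`, `#tors = 2`, `∏c = 8`, 313290k4 `#Ш_an = 9`, `#tors = 2`,
`∏c = 8`; no rational `3`-torsion in the class). Certificate member `W₀ = 313290k1 = [1, -1, 0, -26760, -1912320]`
(Cremona `allbsd`: `r_an = 0`, `#Ш_an(W₀) = 9`, `ord_3 = 2`). Kernel-decided: `Δ(W₀) ≠ 0`, global minimality
(support of `Δ` = `[(2, 1, 6), (3, 2, 3), (5, 1, 1), (59, 2, 6)]` as `(q, v_q N, v_q Δ)`; Silverman/Kraus disjunct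
per prime: 2:a, 3:a, 5:a, 59:a), `3 ∤ #W₀(ℚ)_tors` from `#Ẽ(𝔽_{13}) = 10`. Binders: PUBLISHED `hCT`, `hCassels`,
`hGZK`, `hmod`; per class `hr`, `hs`/`hv`, `hSel : Sel^(3)(W₀/ℚ) ≠ ⊥` — EVIDENCE: kit j257757 (this seat; 2χ
`isogchi.gp` 42175383… / 2cft `isogcft.gp` 0e36e3a0…, unmodified, AGREE, duality PASS) row `313290k1`: rational
`3`-isogeny `φ` with kernel polynomial `x + 44` (kernel field degree `d = 2`) onto `313290k3` (`#tors = 2`, `#Ш_an =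
9`), `(s_φ, ŝ, m, excess) = (1, 1, 0, 2)`, Mordell–Weil split at rank `0` `(q_φ, q_φ̂) = (0, 0)` ⇒ `dim Ш(W₀)[φ] =
s_φ − q_φ = 1 ≥ 1` (and `dim Ш(313290k3)[φ̂] = 1`) ⇒ `Ш(W₀)[3] ≠ 0` ⇒ `Sel^(3)(W₀/ℚ) ≠ ⊥` (`W₀(ℚ)[3] = 0`); `hiso`:
the Cremona class 313290k (4 curves). Per class; nothing booked. [cite: SilvermanAEC2009, Thm. X.4.14 and VII.1
Remark 1.1] [cite: Miller2011LMS, §1 and Def. 1.1] [cite: Cremona2006, Table 1 (Cremona label 313290k1)] -/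
theorem KTPdesc.lower3_sel_313290k1 (hCT : exists_casselsTate_pairing (K := ℚ))
    (hCassels : bsdRHS_eq_of_isIsogenous) (hGZK : rank_eq_analyticRank_of_analyticRank_le_one)
    (hmod : hasEntireLFunction_rat) (W₀ : WeierstrassCurve ℚ) (hW₀ : W₀ = ⟨1, -1, 0, -26760, -1912320⟩)
    (hr : W₀.analyticRank = 0) {s : ℚ} (hs : shaAn W₀ = (s : ℂ)) (hv : padicValRat 3 s ≤ 2)
    (hSel : W₀.selmerGroup (3 : ℤ) ≠ ⊥) (W : WeierstrassCurve ℚ) [W.IsElliptic] [W.IsGloballyMinimal]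
    (hiso : IsIsogenous W W₀) : MissingLowerBoundAt W 3 := by
  subst hW₀
  haveI : Fact (Nat.Prime 3) := ⟨by norm_num⟩
  exact KTPdesc.missingLowerBoundAt_of_isIsogenous_ainvs_of_selmerGroup_ne_bot hCT hCassels hGZK hmod
    1 (-1) 0 (-26760) (-1912320)
    (X11b.isGloballyMinimal_of_krausCriterion_support 1 (-1) 0 (-26760) (-1912320)
      [(2, 1, 6), (3, 2, 3), (5, 1, 1), (59, 2, 6)]
      (by intro t ht; simp only [List.mem_cons, List.not_mem_nil, or_false] at ht; rcases ht with rfl | rfl | rfl | rfl <;> norm_num)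
      (by decide +kernel) (by decide +kernel))
    3 13 (by norm_num) (by norm_num) (by decide +kernel) (n := 10) (by decide +kernel) (by decide)
    hr hs hv hSel W hiso

/-- **L₀ `MissingLowerBoundAt · 3` on the intrinsic (t′) class `355950bj`** (`E[3]` reducible, image `B`; `N =
355950 = 2·3^2·5^2·7·113`; Kodaira type `III` at `3` (`e = 4`); members: 355950bj1 `#Ш_an = 9`, `#tors = 2`, `∏c =
16`, 355950bj2 `#Ш_an = 9`, `#tors = 2`, `∏c = 32`, 355950bj3 `#Ш_an = 9`, `#tors = 2`, `∏c = 48`, 355950bj4 `#Ш_an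
= 9`, `#tors = 2`, `∏c = 96`; no rational `3`-torsion in the class). Certificate member `W₀ = 355950bj1 = [1, -1, 0,
-7881383067, 269311528610341]` (Cremona `allbsd`: `r_an = 0`, `#Ш_an(W₀) = 9`, `ord_3 = 2`). Kernel-decided: `Δ(W₀)
≠ 0`, global minimality (support of `Δ` = `[(2, 1, 12), (3, 2, 3), (5, 2, 9), (7, 1, 9), (113, 1, 2)]` as `(q, v_q
N, v_q Δ)`; Silverman/Kraus disjunct per prime: 2:a, 3:a, 5:a, 7:a, 113:a), `3 ∤ #W₀(ℚ)_tors` from `#Ẽ(𝔽_{13}) =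
16`. Binders: PUBLISHED `hCT`, `hCassels`, `hGZK`, `hmod`; per class `hr`, `hs`/`hv`, `hSel : Sel^(3)(W₀/ℚ) ≠ ⊥` —
EVIDENCE: kit j257757 (this seat; 2χ `isogchi.gp` 42175383… / 2cft `isogcft.gp` 0e36e3a0…, unmodified, AGREE,
duality PASS) row `355950bj1`: rational `3`-isogeny `φ` with kernel polynomial `x - 51334` (kernel field degree `d =
2`) onto `355950bj3` (`#tors = 2`, `#Ш_an = 9`), `(s_φ, ŝ, m, excess) = (1, 1, 0, 2)`, Mordell–Weil split at rank
`0` `(q_φ, q_φ̂) = (0, 0)` ⇒ `dim Ш(W₀)[φ] = s_φ − q_φ = 1 ≥ 1` (and `dim Ш(355950bj3)[φ̂] = 1`) ⇒ `Ш(W₀)[3] ≠ 0` ⇒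
`Sel^(3)(W₀/ℚ) ≠ ⊥` (`W₀(ℚ)[3] = 0`); `hiso`: the Cremona class 355950bj (4 curves). Per class; nothing booked.
[cite: SilvermanAEC2009, Thm. X.4.14 and VII.1 Remark 1.1] [cite: Miller2011LMS, §1 and Def. 1.1] [cite:
Cremona2006, Table 1 (Cremona label 355950bj1)] -/
theorem KTPdesc.lower3_sel_355950bj1 (hCT : exists_casselsTate_pairing (K := ℚ))
    (hCassels : bsdRHS_eq_of_isIsogenous) (hGZK : rank_eq_analyticRank_of_analyticRank_le_one)
    (hmod : hasEntireLFunction_rat) (W₀ : WeierstrassCurve ℚ) (hW₀ : W₀ = ⟨1, -1, 0, -7881383067, 269311528610341⟩)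
    (hr : W₀.analyticRank = 0) {s : ℚ} (hs : shaAn W₀ = (s : ℂ)) (hv : padicValRat 3 s ≤ 2)
    (hSel : W₀.selmerGroup (3 : ℤ) ≠ ⊥) (W : WeierstrassCurve ℚ) [W.IsElliptic] [W.IsGloballyMinimal]
    (hiso : IsIsogenous W W₀) : MissingLowerBoundAt W 3 := by
  subst hW₀
  haveI : Fact (Nat.Prime 3) := ⟨by norm_num⟩
  exact KTPdesc.missingLowerBoundAt_of_isIsogenous_ainvs_of_selmerGroup_ne_bot hCT hCassels hGZK hmod
    1 (-1) 0 (-7881383067) 269311528610341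
    (X11b.isGloballyMinimal_of_krausCriterion_support 1 (-1) 0 (-7881383067) 269311528610341
      [(2, 1, 12), (3, 2, 3), (5, 2, 9), (7, 1, 9), (113, 1, 2)]
      (by intro t ht; simp only [List.mem_cons, List.not_mem_nil, or_false] at ht; rcases ht with rfl | rfl | rfl | rfl | rfl <;> norm_num)
      (by decide +kernel) (by decide +kernel))
    3 13 (by norm_num) (by norm_num) (by decide +kernel) (n := 16) (by decide +kernel) (by decide)
    hr hs hv hSel W hiso

/-- **L₀ `MissingLowerBoundAt · 3` on the intrinsic (t′) class `466578cp`** (`E[3]` reducible, image `B`; `N =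
466578 = 2·3^2·7^2·23^2`; Kodaira type `III` at `3` (`e = 4`); members: 466578cp1 `#Ш_an = 9`, `#tors = 1`, `∏c =
4`, 466578cp2 `#Ш_an = 9`, `#tors = 1`, `∏c = 4`; no rational `3`-torsion in the class). Certificate member `W₀ =
466578cp1 = [1, -1, 0, -2415513, -1444525083]` (Cremona `allbsd`: `r_an = 0`, `#Ш_an(W₀) = 9`, `ord_3 = 2`).
Kernel-decided: `Δ(W₀) ≠ 0`, global minimality (support of `Δ` = `[(2, 1, 3), (3, 2, 3), (7, 2, 8), (23, 2, 6)]` as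
`(q, v_q N, v_q Δ)`; Silverman/Kraus disjunct per prime: 2:a, 3:a, 7:a, 23:a), `3 ∤ #W₀(ℚ)_tors` from `#Ẽ(𝔽_{19}) =
22`. Binders: PUBLISHED `hCT`, `hCassels`, `hGZK`, `hmod`; per class `hr`, `hs`/`hv`, `hSel : Sel^(3)(W₀/ℚ) ≠ ⊥` —
EVIDENCE: kit j257757 (this seat; 2χ `isogchi.gp` 42175383… / 2cft `isogcft.gp` 0e36e3a0…, unmodified, AGREE,
duality PASS) row `466578cp1`: rational `3`-isogeny `φ` with kernel polynomial `x + 845` (kernel field degree `d =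
2`) onto `466578cp2` (`#tors = 1`, `#Ш_an = 9`), `(s_φ, ŝ, m, excess) = (1, 1, 0, 2)`, Mordell–Weil split at rank
`0` `(q_φ, q_φ̂) = (0, 0)` ⇒ `dim Ш(W₀)[φ] = s_φ − q_φ = 1 ≥ 1` (and `dim Ш(466578cp2)[φ̂] = 1`) ⇒ `Ш(W₀)[3] ≠ 0` ⇒
`Sel^(3)(W₀/ℚ) ≠ ⊥` (`W₀(ℚ)[3] = 0`); `hiso`: the Cremona class 466578cp (2 curves). Per class; nothing booked.
[cite: SilvermanAEC2009, Thm. X.4.14 and VII.1 Remark 1.1] [cite: Miller2011LMS, §1 and Def. 1.1] [cite: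
Cremona2006, Table 1 (Cremona label 466578cp1)] -/
theorem KTPdesc.lower3_sel_466578cp1 (hCT : exists_casselsTate_pairing (K := ℚ))
    (hCassels : bsdRHS_eq_of_isIsogenous) (hGZK : rank_eq_analyticRank_of_analyticRank_le_one)
    (hmod : hasEntireLFunction_rat) (W₀ : WeierstrassCurve ℚ) (hW₀ : W₀ = ⟨1, -1, 0, -2415513, -1444525083⟩)
    (hr : W₀.analyticRank = 0) {s : ℚ} (hs : shaAn W₀ = (s : ℂ)) (hv : padicValRat 3 s ≤ 2)
    (hSel : W₀.selmerGroup (3 : ℤ) ≠ ⊥) (W : WeierstrassCurve ℚ) [W.IsElliptic] [W.IsGloballyMinimal]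
    (hiso : IsIsogenous W W₀) : MissingLowerBoundAt W 3 := by
  subst hW₀
  haveI : Fact (Nat.Prime 3) := ⟨by norm_num⟩
  exact KTPdesc.missingLowerBoundAt_of_isIsogenous_ainvs_of_selmerGroup_ne_bot hCT hCassels hGZK hmod
    1 (-1) 0 (-2415513) (-1444525083)
    (X11b.isGloballyMinimal_of_krausCriterion_support 1 (-1) 0 (-2415513) (-1444525083)
      [(2, 1, 3), (3, 2, 3), (7, 2, 8), (23, 2, 6)]
      (by intro t ht; simp only [List.mem_cons, List.not_mem_nil, or_false] at ht; rcases ht with rfl | rfl | rfl | rfl <;> norm_num)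
      (by decide +kernel) (by decide +kernel))
    3 19 (by norm_num) (by norm_num) (by decide +kernel) (n := 22) (by decide +kernel) (by decide)
    hr hs hv hSel W hiso

/-- **L₀ `MissingLowerBoundAt · 3` on the intrinsic (t′) class `481050t`** (`E[3]` reducible, image `B`; `N = 481050
= 2·3^2·5^2·1069`; Kodaira type `III` at `3` (`e = 4`); members: 481050t1 `#Ш_an = 9`, `#tors = 1`, `∏c = 2`,
481050t2 `#Ш_an = 9`, `#tors = 1`, `∏c = 6`; no rational `3`-torsion in the class). Certificate member `W₀ =
481050t1 = [1, -1, 0, -1753467, 474563941]` (Cremona `allbsd`: `r_an = 0`, `#Ш_an(W₀) = 9`, `ord_3 = 2`).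
Kernel-decided: `Δ(W₀) ≠ 0`, global minimality (support of `Δ` = `[(2, 1, 39), (3, 2, 3), (5, 2, 6), (1069, 1, 1)]`
as `(q, v_q N, v_q Δ)`; Silverman/Kraus disjunct per prime: 2:a, 3:a, 5:a, 1069:a), `3 ∤ #W₀(ℚ)_tors` from
`#Ẽ(𝔽_{7}) = 4`. Binders: PUBLISHED `hCT`, `hCassels`, `hGZK`, `hmod`; per class `hr`, `hs`/`hv`, `hSel :
Sel^(3)(W₀/ℚ) ≠ ⊥` — EVIDENCE: kit j257757 (this seat; 2χ `isogchi.gp` 42175383… / 2cft `isogcft.gp` 0e36e3a0…,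
unmodified, AGREE, duality PASS) row `481050t1`: rational `3`-isogeny `φ` with kernel polynomial `x - 1654` (kernel
field degree `d = 2`) onto `481050t2` (`#tors = 1`, `#Ш_an = 9`), `(s_φ, ŝ, m, excess) = (1, 1, 0, 2)`, Mordell–Weil
split at rank `0` `(q_φ, q_φ̂) = (0, 0)` ⇒ `dim Ш(W₀)[φ] = s_φ − q_φ = 1 ≥ 1` (and `dim Ш(481050t2)[φ̂] = 1`) ⇒
`Ш(W₀)[3] ≠ 0` ⇒ `Sel^(3)(W₀/ℚ) ≠ ⊥` (`W₀(ℚ)[3] = 0`); `hiso`: the Cremona class 481050t (2 curves). Per class;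
nothing booked. [cite: SilvermanAEC2009, Thm. X.4.14 and VII.1 Remark 1.1] [cite: Miller2011LMS, §1 and Def. 1.1]
[cite: Cremona2006, Table 1 (Cremona label 481050t1)] -/
theorem KTPdesc.lower3_sel_481050t1 (hCT : exists_casselsTate_pairing (K := ℚ))
    (hCassels : bsdRHS_eq_of_isIsogenous) (hGZK : rank_eq_analyticRank_of_analyticRank_le_one)
    (hmod : hasEntireLFunction_rat) (W₀ : WeierstrassCurve ℚ) (hW₀ : W₀ = ⟨1, -1, 0, -1753467, 474563941⟩)
    (hr : W₀.analyticRank = 0) {s : ℚ} (hs : shaAn W₀ = (s : ℂ)) (hv : padicValRat 3 s ≤ 2)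
    (hSel : W₀.selmerGroup (3 : ℤ) ≠ ⊥) (W : WeierstrassCurve ℚ) [W.IsElliptic] [W.IsGloballyMinimal]
    (hiso : IsIsogenous W W₀) : MissingLowerBoundAt W 3 := by
  subst hW₀
  haveI : Fact (Nat.Prime 3) := ⟨by norm_num⟩
  exact KTPdesc.missingLowerBoundAt_of_isIsogenous_ainvs_of_selmerGroup_ne_bot hCT hCassels hGZK hmod
    1 (-1) 0 (-1753467) 474563941
    (X11b.isGloballyMinimal_of_krausCriterion_support 1 (-1) 0 (-1753467) 474563941
      [(2, 1, 39), (3, 2, 3), (5, 2, 6), (1069, 1, 1)]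
      (by intro t ht; simp only [List.mem_cons, List.not_mem_nil, or_false] at ht; rcases ht with rfl | rfl | rfl | rfl <;> norm_num)
      (by decide +kernel) (by decide +kernel))
    3 7 (by norm_num) (by norm_num) (by decide +kernel) (n := 4) (by decide +kernel) (by decide)
    hr hs hv hSel W hiso

/-- **L₀ `MissingLowerBoundAt · 3` on the intrinsic (t′) class `486720gq`** (`E[3]` reducible, image `B`; `N =
486720 = 2^6·3^2·5·13^2`; Kodaira type `III` at `3` (`e = 4`); members: 486720gq1 `#Ш_an = 9`, `#tors = 2`, `∏c =
16`, 486720gq2 `#Ш_an = 9`, `#tors = 2`, `∏c = 16`, 486720gq3 `#Ш_an = 9`, `#tors = 2`, `∏c = 16`, 486720gq4 `#Ш_an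
= 9`, `#tors = 2`, `∏c = 16`; no rational `3`-torsion in the class). Certificate member `W₀ = 486720gq1 = [0, 0, 0,
-83148, -10510448]` (Cremona `allbsd`: `r_an = 0`, `#Ш_an(W₀) = 9`, `ord_3 = 2`). Kernel-decided: `Δ(W₀) ≠ 0`,
global minimality (support of `Δ` = `[(2, 6, 24), (3, 2, 3), (5, 1, 1), (13, 2, 6)]` as `(q, v_q N, v_q Δ)`;
Silverman/Kraus disjunct per prime: 2:b, 3:a, 5:a, 13:a), `3 ∤ #W₀(ℚ)_tors` from `#Ẽ(𝔽_{19}) = 16`. Binders: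
PUBLISHED `hCT`, `hCassels`, `hGZK`, `hmod`; per class `hr`, `hs`/`hv`, `hSel : Sel^(3)(W₀/ℚ) ≠ ⊥` — EVIDENCE: kit
j257757 (this seat; 2χ `isogchi.gp` 42175383… / 2cft `isogcft.gp` 0e36e3a0…, unmodified, AGREE, duality PASS) row
`486720gq1`: rational `3`-isogeny `φ` with kernel polynomial `x + 78` (kernel field degree `d = 2`) onto `486720gq3`
(`#tors = 2`, `#Ш_an = 9`), `(s_φ, ŝ, m, excess) = (1, 1, 0, 2)`, Mordell–Weil split at rank `0` `(q_φ, q_φ̂) = (0,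
0)` ⇒ `dim Ш(W₀)[φ] = s_φ − q_φ = 1 ≥ 1` (and `dim Ш(486720gq3)[φ̂] = 1`) ⇒ `Ш(W₀)[3] ≠ 0` ⇒ `Sel^(3)(W₀/ℚ) ≠ ⊥`
(`W₀(ℚ)[3] = 0`); `hiso`: the Cremona class 486720gq (4 curves). Per class; nothing booked. [cite: SilvermanAEC2009,
Thm. X.4.14 and VII.1 Remark 1.1] [cite: Miller2011LMS, §1 and Def. 1.1] [cite: Cremona2006, Table 1 (Cremona label
486720gq1)] -/
theorem KTPdesc.lower3_sel_486720gq1 (hCT : exists_casselsTate_pairing (K := ℚ))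
    (hCassels : bsdRHS_eq_of_isIsogenous) (hGZK : rank_eq_analyticRank_of_analyticRank_le_one)
    (hmod : hasEntireLFunction_rat) (W₀ : WeierstrassCurve ℚ) (hW₀ : W₀ = ⟨0, 0, 0, -83148, -10510448⟩)
    (hr : W₀.analyticRank = 0) {s : ℚ} (hs : shaAn W₀ = (s : ℂ)) (hv : padicValRat 3 s ≤ 2)
    (hSel : W₀.selmerGroup (3 : ℤ) ≠ ⊥) (W : WeierstrassCurve ℚ) [W.IsElliptic] [W.IsGloballyMinimal]
    (hiso : IsIsogenous W W₀) : MissingLowerBoundAt W 3 := by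
  subst hW₀
  haveI : Fact (Nat.Prime 3) := ⟨by norm_num⟩
  exact KTPdesc.missingLowerBoundAt_of_isIsogenous_ainvs_of_selmerGroup_ne_bot hCT hCassels hGZK hmod
    0 0 0 (-83148) (-10510448)
    (X11b.isGloballyMinimal_of_krausCriterion_support 0 0 0 (-83148) (-10510448)
      [(2, 6, 24), (3, 2, 3), (5, 1, 1), (13, 2, 6)]
      (by intro t ht; simp only [List.mem_cons, List.not_mem_nil, or_false] at ht; rcases ht with rfl | rfl | rfl | rfl <;> norm_num)
      (by decide +kernel) (by decide +kernel))
    3 19 (by norm_num) (by norm_num) (by decide +kernel) (n := 16) (by decide +kernel) (by decide)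
    hr hs hv hSel W hiso

/-- **L₀ `MissingLowerBoundAt · 3` on the intrinsic (t′) class `487872jp`** (`E[3]` reducible, image `B`; `N =
487872 = 2^6·3^2·7·11^2`; Kodaira type `III` at `3` (`e = 4`); members: 487872jp1 `#Ш_an = 9`, `#tors = 1`, `∏c =
4`, 487872jp2 `#Ш_an = 9`, `#tors = 1`, `∏c = 12`; no rational `3`-torsion in the class). Certificate member `W₀ =
487872jp1 = [0, 0, 0, -11419980, -80368314224]` (Cremona `allbsd`: `r_an = 0`, `#Ш_an(W₀) = 9`, `ord_3 = 2`).
Kernel-decided: `Δ(W₀) ≠ 0`, global minimality (support of `Δ` = `[(2, 6, 39), (3, 2, 3), (7, 1, 1), (11, 2, 10)]`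
as `(q, v_q N, v_q Δ)`; Silverman/Kraus disjunct per prime: 2:b, 3:a, 7:a, 11:a), `3 ∤ #W₀(ℚ)_tors` from `#Ẽ(𝔽_{19})
= 22`. Binders: PUBLISHED `hCT`, `hCassels`, `hGZK`, `hmod`; per class `hr`, `hs`/`hv`, `hSel : Sel^(3)(W₀/ℚ) ≠ ⊥` —
EVIDENCE: kit j257757 (this seat; 2χ `isogchi.gp` 42175383… / 2cft `isogcft.gp` 0e36e3a0…, unmodified, AGREE,
duality PASS) row `487872jp1`: rational `3`-isogeny `φ` with kernel polynomial `x - 7986` (kernel field degree `d =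
2`) onto `487872jp2` (`#tors = 1`, `#Ш_an = 9`), `(s_φ, ŝ, m, excess) = (1, 1, 0, 2)`, Mordell–Weil split at rank
`0` `(q_φ, q_φ̂) = (0, 0)` ⇒ `dim Ш(W₀)[φ] = s_φ − q_φ = 1 ≥ 1` (and `dim Ш(487872jp2)[φ̂] = 1`) ⇒ `Ш(W₀)[3] ≠ 0` ⇒
`Sel^(3)(W₀/ℚ) ≠ ⊥` (`W₀(ℚ)[3] = 0`); `hiso`: the Cremona class 487872jp (2 curves). Per class; nothing booked.
[cite: SilvermanAEC2009, Thm. X.4.14 and VII.1 Remark 1.1] [cite: Miller2011LMS, §1 and Def. 1.1] [cite: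
Cremona2006, Table 1 (Cremona label 487872jp1)] -/
theorem KTPdesc.lower3_sel_487872jp1 (hCT : exists_casselsTate_pairing (K := ℚ))
    (hCassels : bsdRHS_eq_of_isIsogenous) (hGZK : rank_eq_analyticRank_of_analyticRank_le_one)
    (hmod : hasEntireLFunction_rat) (W₀ : WeierstrassCurve ℚ) (hW₀ : W₀ = ⟨0, 0, 0, -11419980, -80368314224⟩)
    (hr : W₀.analyticRank = 0) {s : ℚ} (hs : shaAn W₀ = (s : ℂ)) (hv : padicValRat 3 s ≤ 2)
    (hSel : W₀.selmerGroup (3 : ℤ) ≠ ⊥) (W : WeierstrassCurve ℚ) [W.IsElliptic] [W.IsGloballyMinimal]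
    (hiso : IsIsogenous W W₀) : MissingLowerBoundAt W 3 := by
  subst hW₀
  haveI : Fact (Nat.Prime 3) := ⟨by norm_num⟩
  exact KTPdesc.missingLowerBoundAt_of_isIsogenous_ainvs_of_selmerGroup_ne_bot hCT hCassels hGZK hmod
    0 0 0 (-11419980) (-80368314224)
    (X11b.isGloballyMinimal_of_krausCriterion_support 0 0 0 (-11419980) (-80368314224)
      [(2, 6, 39), (3, 2, 3), (7, 1, 1), (11, 2, 10)]
      (by intro t ht; simp only [List.mem_cons, List.not_mem_nil, or_false] at ht; rcases ht with rfl | rfl | rfl | rfl <;> norm_num)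
      (by decide +kernel) (by decide +kernel))
    3 19 (by norm_num) (by norm_num) (by decide +kernel) (n := 22) (by decide +kernel) (by decide)
    hr hs hv hSel W hiso

end Summit.BirchSwinnertonDyer.BirchSwinnertonDyer.Theorems

end
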